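import Summits.Ventures.HodgeRepro.Night1ProductWeilMatching

/-!
# Degree 4 is divisorial: for a quartic CM field the four corners of a «face» pair off into complementary
pairs, so its Weil space is generated by divisor classes — the frontier of S4 starts in degree 6

Blind re-derivation cell `pub-hodge-repro`, seat `night-1` (gen 5, seventeenth file).  Imports night-1's
`Night1ProductWeilMatching` (the dichotomy: `W ≤ D^k` iff the corners admit a complementary pairing).

`Night1ProductWeilExceptional` proved that no two corners of a face `(Φ; p, p')` are complementary when
`|G| > 4`, and noted that in degree 4 the corners `1`, `2` ARE complementary.  This file records the other
side of the dichotomy in degree 4: with `|G| = 4` the two places `{p, c p}`, `{p', c p'}` exhaust `G`, the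
corners pair off — `Φ^{(p p')} = Φ̄ = Φᶜ` and `(Φ̄)^{(p')} = ((Φ̄)^{(p)})ᶜ` — so the face has a complementary
pairing and its Weil space is divisorial:

* `place_union_eq_univ_of_card_eq_four` — the two places cover `G`;
* `faceCorners_three_eq_compl` / `faceCorners_two_eq_compl` — the two complementary pairs;
* **`faceCorners_hasComplPairing_of_card_eq_four`** — the pairing `{0, 3}, {1, 2}`;
* **`face_weilSpaceProd_le_divisorPowerIn_of_card_eq_four`** — `W ≤ D²` on the four-corner product.

Reading (paper-level, NIGHT1.md §12): for a quartic CM field the «Weil classes» of the four-corner product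
are products of divisor classes (the conjugate corners `A_Φ`, `A_{Φ̄}` carry the Poincaré-type divisors) —
which is why ROUTE.md's open frontier S4 starts with the Galois CM fields of degree `≥ 6`, the first degree
in which a rank-four face has no complementary corners.  Nothing geometric is built; nothing here says
anything about the status of the Hodge conjecture for CM abelian varieties, which is NOT proved.
-/

set_option autoImplicit false

open Finset
open scoped Pointwise

namespace HodgeRepro.RouteC

open CMHodgeOn

section DegreeFour

variable {G : Type*} [Group G] [DecidableEq G] [Fintype G]

omit [Fintype G] in
/-- A place has two elements (`c ≠ 1`). -/
theorem card_place_eq_two {c : G} (hc : IsComplexConj c) (p : G) : (place c p).card = 2 := by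
  rw [place, card_pair]
  intro h
  exact hc.ne_one (by simpa using h.symm)

/-- In degree 4 two distinct places cover `G`. -/
theorem place_union_eq_univ_of_card_eq_four {c : G} (hc : IsComplexConj c) {p p' : G}
    (hπ : p' ∉ place c p) (h4 : Fintype.card G = 4) : place c p ∪ place c p' = univ := by
  refine eq_univ_of_card _ ?_
  rw [card_union_of_disjoint (disjoint_place hc hπ), card_place_eq_two hc, card_place_eq_two hc, h4]

/-- In degree 4 the corner `3` is the complement of the corner `0`: `Φ ∆ P ∆ P' = Φᶜ`. -/
theorem faceCorners_three_eq_compl {c : G} (hc : IsComplexConj c) (Φ : Finset G) {p p' : G}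
    (hπ : p' ∉ place c p) (h4 : Fintype.card G = 4) :
    faceCorners c Φ p p' 3 = (faceCorners c Φ p p' 0)ᶜ := by
  have hcover := place_union_eq_univ_of_card_eq_four hc hπ h4
  have hdisj := disjoint_place hc hπ
  ext x
  have hx : x ∈ place c p ∨ x ∈ place c p' := by
    have : x ∈ place c p ∪ place c p' := hcover ▸ mem_univ x
    exact mem_union.1 this
  have hnot : ¬ (x ∈ place c p ∧ x ∈ place c p') := fun h => disjoint_left.1 hdisj h.1 h.2
  simp only [faceCorners, mem_flipAt, mem_compl]
  tauto

/-- In degree 4 the corner `2` is the complement of the corner `1`: `Φ̄ ∆ P' = (Φ̄ ∆ P)ᶜ`. -/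
theorem faceCorners_two_eq_compl {c : G} (hc : IsComplexConj c) {Φ : Finset G} (hΦ : IsCMType c Φ)
    {p p' : G} (hπ : p' ∉ place c p) (h4 : Fintype.card G = 4) :
    faceCorners c Φ p p' 2 = (faceCorners c Φ p p' 1)ᶜ := by
  have hcover := place_union_eq_univ_of_card_eq_four hc hπ h4
  have hdisj := disjoint_place hc hπ
  ext x
  have hx : x ∈ place c p ∨ x ∈ place c p' := by
    have : x ∈ place c p ∪ place c p' := hcover ▸ mem_univ x
    exact mem_union.1 this
  have hnot : ¬ (x ∈ place c p ∧ x ∈ place c p') := fun h => disjoint_left.1 hdisj h.1 h.2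
  simp only [faceCorners, mem_flipAt, mem_compl, hΦ.smul_eq_compl hc]
  tauto

/-- The pairing `{0, 3}, {1, 2}` of the four corners, as a concatenation of two pairs. -/
def degreeFourPairing : Fin 2 → Fin 2 → Fin 4 := ![![0, 3], ![1, 2]]

/-- The pairing is a bijection `Fin 4 → Fin 4`. -/
theorem degreeFourPairing_bijective : Function.Bijective (concatPairs degreeFourPairing) := by
  decide

/-- **In degree 4 a face has a complementary pairing.** -/
theorem faceCorners_hasComplPairing_of_card_eq_four {c : G} (hc : IsComplexConj c) {Φ : Finset G}
    (hΦ : IsCMType c Φ) {p p' : G} (hπ : p' ∉ place c p) (h4 : Fintype.card G = 4) :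
    HasComplPairing 2 (faceCorners c Φ p p') := by
  refine ⟨degreeFourPairing, degreeFourPairing_bijective, ?_⟩
  intro j
  fin_cases j
  · exact faceCorners_three_eq_compl hc Φ hπ h4
  · exact faceCorners_two_eq_compl hc hΦ hπ h4

/-- **In degree 4 the Weil space of a face is generated by divisor classes**: on the four-corner product
the Weil space lies in the products of two divisor classes. -/
theorem face_weilSpaceProd_le_divisorPowerIn_of_card_eq_four {c : G} (hc : IsComplexConj c)
    {Φ : Finset G} (hΦ : IsCMType c Φ) {p p' : G} (hπ : p' ∉ place c p) (h4 : Fintype.card G = 4) :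
    weilSpaceProd G 2 (Equiv.refl (Fin (2 * 2))) ≤
      divisorPowerIn (fun g : G => prodTypeSet fun i => g • faceCorners c Φ p p' i) 2 :=
  weilSpaceProd_le_divisorPowerIn_of_hasComplPairing _
    (faceCorners_hasComplPairing_of_card_eq_four hc hΦ hπ h4) _

end DegreeFour

end HodgeRepro.RouteC
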